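/-
Copyright (c) 2026 the pub-hodgecm-mathlib formalisation cell (harness21).  Prover seat hodgecm-mathlib-LH4-p04 (g7), req620 Track A «(D-RAM) FOUR-FRAME» squad
(STAGE-1b, heir LEAD F0P3a-plan (g20∕g21) «row T₊ DERIVED»; dealer∕pen LH4-plan (g12∕g13) WORD #48∕#52 «(C2-lev-m_c)»; row-(2) lead LH4-p07 (g8)), 2026-09-04.
-/
import Summits.HodgeConjecture.HodgeConjecture.Theorems.F0P3cDyRamLevelsCensusOrderFormCM     -- ★ p859421 (this seat): §0 `latticeInLevel_and_conj_mapGL_iff`; brings ★ FormTransport `ncard_selfDual_fixed_sep_eq_of_formCongr`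
import Summits.HodgeConjecture.HodgeConjecture.Theorems.F0P3cDyRamLevelsPieceCountDictionary   -- ★ p858704 (LH4-p06 (g6)): the `pieceCountDictionary_levels` token; brings ★ p854742 `coe_mem_unitaryGroupOfForm_over`
import HarnessLib

/-!
# Crux `H413`, line LH4 «(D-RAM) FOUR-FRAME» — STAGE-1b, row (2): brick (C2-lev-class) «THE LEVEL CENSUS `cnt_{a,b}` IS A CLASS FUNCTION ON `G_v`»

Cell `hodgecm-mathlib` (D-0151), FLOOR 0, crux item H413 = `stmt-HodgeConjecture-24833`, route of record `HCCMUnconditional`; squad F0∕P3c∕LH4; lane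
`--supports stmt-HodgeConjecture-24833 --as helper` (count-neutral; pays NO tier-0 row).  THEOREMS ONLY (no `def`, no instance, no notation, no `sorry`, default heartbeats).

WHY.  The (C2-lev-dict) unfolding (this seat, `F0P3cDyRamLevelsTypeTwoDictionary`) reads the κ-orbital integral of a level piece `𝟙_{K_{a,b}}` on a type-(2) `γ_H` as
`τ·D·νG₃(K)·(cnt_{a,b}(ι_w δ₊) − cnt_{a,b}(ι_w δ₋))` at SOME matches `δ_±` of κ-signs `±1`, each determined up to `G_v`-conjugacy (★ p847309's exhaustion clauses
`IsConj δ_± δ`); the census identities ★ p859421 ∕ ★ p859485 (this seat) and LH4-p07 (g8)'s organs price `cnt_{a,b}` at the two LITERAL SHAPES of socket (C″)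
(`ι_w t_h = endoGL (ι_w γ_H.1, ι_w γ_H.2)`, `ι_w t_a = P₁·endoGL (γ₁, ι_w γ_H.2)·P₁⁻¹`).  To move from `δ_±` to the literals one needs exactly: `cnt_{a,b} ∘ ι_w` is constant on
`G_v`-conjugacy classes.  It is — `ι_w` is a homomorphism into `U(σ_w, (Φ₃)_w)`, a unitary `P` permutes the type-0 vertices of `(Φ₃)_w` (`formCongr σ P Φ₃ = Φ₃`), and the
fixedness and the two level labels transport under `M ↦ P·M`, `γ ↦ PγP⁻¹` (★ FormTransport `ncard_selfDual_fixed_sep_eq_of_formCongr` with ★ p859421 §0's label transport).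
* §1 `ncard_typeZero_fixed_levels_conj_eq` — valued-field letters: for `P ∈ U(σ, antidiag₃)` and ANY `γ ∈ GL₃`, `cnt_{a,b}(PγP⁻¹) = cnt_{a,b}(γ)`.
* §2 `ncard_typeZero_fixed_levels_eq_of_isConj` — at the CM place: `IsConj δ δ′ → cnt_{a,b}(ι_w δ′) = cnt_{a,b}(ι_w δ)` (★ p858704's token VERBATIM on both sides).
HONEST LABEL.  Count-neutral lattice bookkeeping; nothing printed is asserted; no census law is stated; `HC_CM` is proved only modulo the 7 printed citations (2 remaining named
inputs: hLiu418 = `stmt-HodgeConjecture-24832`, h413 = `stmt-HodgeConjecture-24833`) until rung 0 closes.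
## References
* [Kottwitz1986BaseChangeUnits] R. E. Kottwitz, *Base change for unit elements of Hecke algebras*, Compositio Math. 60 (1986): §1 pp. 240–241.
* [Rogawski1990] J. D. Rogawski, *Automorphic Representations of Unitary Groups in Three Variables*, Ann. of Math. Stud. 123 (1990): §4.3 (4.3.1) p. 43; §4.9 Prop. 4.9.1 (b) p. 55, Lemma 4.9.3 p. 56.
* [Jacobowitz1962] R. Jacobowitz, *Hermitian forms over local fields*, Amer. J. Math. 84 (1962): §4.
-/

set_option autoImplicit false

noncomputable section
namespace Summit.HodgeConjecture.HodgeConjecture.Cruxes.H413.F0P3cDyRamLevelsCensusClassFunction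

open MeasureTheory Measure NumberField IsDedekindDomain Topology Filter
open Literature.NumberTheory.Automorphic Literature.NumberTheory.Automorphic.UnitaryGroup Literature.NumberTheory.Automorphic.IntegralReduction
open Literature.NumberTheory.Rogawski1990 Literature.NumberTheory.GaloisRepresentations
open Literature.NumberTheory.Automorphic.UnitaryThreeFourFrame
open scoped Matrix MatrixGroups Classical Valued WithZero
open Literature.NumberTheory.Automorphic.UnitaryLatticeTree Literature.NumberTheory.Automorphic.HermitianLattice
open Summit.HodgeConjecture.HodgeConjecture.Cruxes.H413.F0P3cDyRamFourFrameCensusDefs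
open Summit.HodgeConjecture.HodgeConjecture.Cruxes.H413.F0P3cDyRamProfilePiecesProps
open Summit.HodgeConjecture.HodgeConjecture.Cruxes.H413.F0P3cDyRamLevelsCensusOrderFormCM

/-! ## §1 Valued-field letters: a unitary conjugation does not change the level census -/

section Valued

variable {K : Type*} [Field K] [Valued K ℤᵐ⁰]

/-- **`cnt_{a,b}` IS INVARIANT UNDER UNITARY CONJUGATION**: for `P ∈ U(σ, antidiag₃)` and any `γ ∈ GL₃(K)`,
`#{M ∣ type-0, (PγP⁻¹)·M = M, (PγP⁻¹ − 1)M ⊆ ϖ^a M, (PγP⁻¹ − 1)²M ⊆ ϖ^b M} = #{M ∣ type-0, γ·M = M, (γ − 1)M ⊆ ϖ^a M, (γ − 1)²M ⊆ ϖ^b M}` (★ FormTransport count transport along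
`M ↦ P·M` with the two level labels, ★ p859421 §0; `formCongr σ P Φ₃ = Φ₃`). [cite: Kottwitz1986BaseChangeUnits, §1 pp. 240–241] [cite: Rogawski1990, §4.9 Lemma 4.9.3 p. 56] [cite: Jacobowitz1962, §4] -/
theorem ncard_typeZero_fixed_levels_conj_eq (σ : K →+* K) (ϖ : K) (a b : ℕ) (P γ : GL (Fin 3) K)
    (hP : P ∈ unitaryGroupOfForm σ ((StdForm.antidiagonal 3).over K)) :
    {M : Submodule 𝒪[K] (Fin 3 → K) | IsVertexLattice σ ϖ ((StdForm.antidiagonal 3).over K) 0 M ∧ mapGL (P * γ * P⁻¹) M = M ∧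
        (LatticeInLevel ϖ a (((P * γ * P⁻¹ : GL (Fin 3) K) : Matrix (Fin 3) (Fin 3) K) - 1) M ∧
          LatticeInLevel ϖ b ((((P * γ * P⁻¹ : GL (Fin 3) K) : Matrix (Fin 3) (Fin 3) K) - 1) * (((P * γ * P⁻¹ : GL (Fin 3) K) : Matrix (Fin 3) (Fin 3) K) - 1)) M)}.ncard =
      {M : Submodule 𝒪[K] (Fin 3 → K) | IsVertexLattice σ ϖ ((StdForm.antidiagonal 3).over K) 0 M ∧ mapGL γ M = M ∧
        (LatticeInLevel ϖ a ((γ : Matrix (Fin 3) (Fin 3) K) - 1) M ∧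
          LatticeInLevel ϖ b (((γ : Matrix (Fin 3) (Fin 3) K) - 1) * ((γ : Matrix (Fin 3) (Fin 3) K) - 1)) M)}.ncard := by
  have h := ncard_selfDual_fixed_sep_eq_of_formCongr σ ϖ ((StdForm.antidiagonal 3).over K) P γ
    (fun M => LatticeInLevel ϖ a (((P * γ * P⁻¹ : GL (Fin 3) K) : Matrix (Fin 3) (Fin 3) K) - 1) M ∧
      LatticeInLevel ϖ b ((((P * γ * P⁻¹ : GL (Fin 3) K) : Matrix (Fin 3) (Fin 3) K) - 1) * (((P * γ * P⁻¹ : GL (Fin 3) K) : Matrix (Fin 3) (Fin 3) K) - 1)) M)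
    (fun M => LatticeInLevel ϖ a ((γ : Matrix (Fin 3) (Fin 3) K) - 1) M ∧
      LatticeInLevel ϖ b (((γ : Matrix (Fin 3) (Fin 3) K) - 1) * ((γ : Matrix (Fin 3) (Fin 3) K) - 1)) M)
    (fun M => latticeInLevel_and_conj_mapGL_iff ϖ a b P γ M)
  have hfc : formCongr σ P ((StdForm.antidiagonal 3).over K) = (StdForm.antidiagonal 3).over K := mem_unitaryGroupOfForm_iff.1 hP
  rw [hfc] at h
  exact h

end Valued

/-! ## §2 At the CM place: `cnt_{a,b} ∘ ι_w` is constant on `G_v`-conjugacy classes -/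

/-- **THE LEVEL CENSUS IS A CLASS FUNCTION ON `G_v`**: at a non-split CM place `w ∣ v`, for `δ, δ′ ∈ G_v` with `IsConj δ δ′`, ★ p858704's census token agrees at `ι_w δ′` and
`ι_w δ` — `cnt_{a,b}(ι_w δ′) = cnt_{a,b}(ι_w δ)` (`δ′ = cδc⁻¹`, `ι_w` a homomorphism into `U(σ_w, (Φ₃)_w)` ★ `coe_mem_unitaryGroupOfForm_over`, §1 at `P := ι_w c`).  With (C2-lev-dict)'s
exhaustion clauses this moves the two counts from the abstract matches `δ_±` to any chosen representatives — the literal shapes of socket (C″).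
[cite: Kottwitz1986BaseChangeUnits, §1 pp. 240–241] [cite: Rogawski1990, §4.3 (4.3.1) p. 43; §4.9 Prop. 4.9.1 (b) p. 55] -/
theorem ncard_typeZero_fixed_levels_eq_of_isConj (L : Type) [Field L] [NumberField L] [IsCMField L]
    {v : HeightOneSpectrum (𝓞 ↥(maximalRealSubfield L))} (w : UnitaryGroup.PlacesOver L v)
    (hw : IsCMField.complexConj L • w.1 = w.1) (ϖ : (w.1.adicCompletion L)) (a b : ℕ)
    {δ δ' : ((UnitaryGroup.cmDatum L 3 (Matrix.of fun i j : Fin 3 => if i.val + j.val + 1 = 3 then (1 : L) else 0)).Local v)} (hconj : IsConj δ δ') :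
    {M : Submodule (Valued.integer (w.1.adicCompletion L)) (Fin 3 → w.1.adicCompletion L) |
        IsVertexLattice (galAdicCompletionMap (L := L) (IsCMField.complexConj L) hw) ϖ ((StdForm.antidiagonal 3).over (w.1.adicCompletion L)) 0 M ∧
          mapGL ((localNonsplitEquiv (IsCMField.complexConj L) (Matrix.of fun i j : Fin 3 => if i.val + j.val + 1 = 3 then (1 : L) else 0) (IsCMField.complexConj_ne_one L) w hw δ' :
            ↥(unitaryGroupOfForm (galAdicCompletionMap (L := L) (IsCMField.complexConj L) hw) (placeForm (Matrix.of fun i j : Fin 3 => if i.val + j.val + 1 = 3 then (1 : L) else 0) w.1))) : GL (Fin 3) (w.1.adicCompletion L)) M = M ∧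
          (LatticeInLevel ϖ a ((((localNonsplitEquiv (IsCMField.complexConj L) (Matrix.of fun i j : Fin 3 => if i.val + j.val + 1 = 3 then (1 : L) else 0) (IsCMField.complexConj_ne_one L) w hw δ' :
            ↥(unitaryGroupOfForm (galAdicCompletionMap (L := L) (IsCMField.complexConj L) hw) (placeForm (Matrix.of fun i j : Fin 3 => if i.val + j.val + 1 = 3 then (1 : L) else 0) w.1))) : GL (Fin 3) (w.1.adicCompletion L)) : Matrix (Fin 3) (Fin 3) (w.1.adicCompletion L)) - 1) M ∧
            LatticeInLevel ϖ b (((((localNonsplitEquiv (IsCMField.complexConj L) (Matrix.of fun i j : Fin 3 => if i.val + j.val + 1 = 3 then (1 : L) else 0) (IsCMField.complexConj_ne_one L) w hw δ' :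
              ↥(unitaryGroupOfForm (galAdicCompletionMap (L := L) (IsCMField.complexConj L) hw) (placeForm (Matrix.of fun i j : Fin 3 => if i.val + j.val + 1 = 3 then (1 : L) else 0) w.1))) : GL (Fin 3) (w.1.adicCompletion L)) : Matrix (Fin 3) (Fin 3) (w.1.adicCompletion L)) - 1) *
              ((((localNonsplitEquiv (IsCMField.complexConj L) (Matrix.of fun i j : Fin 3 => if i.val + j.val + 1 = 3 then (1 : L) else 0) (IsCMField.complexConj_ne_one L) w hw δ' :
              ↥(unitaryGroupOfForm (galAdicCompletionMap (L := L) (IsCMField.complexConj L) hw) (placeForm (Matrix.of fun i j : Fin 3 => if i.val + j.val + 1 = 3 then (1 : L) else 0) w.1))) : GL (Fin 3) (w.1.adicCompletion L)) : Matrix (Fin 3) (Fin 3) (w.1.adicCompletion L)) - 1)) M)}.ncard =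
      {M : Submodule (Valued.integer (w.1.adicCompletion L)) (Fin 3 → w.1.adicCompletion L) |
        IsVertexLattice (galAdicCompletionMap (L := L) (IsCMField.complexConj L) hw) ϖ ((StdForm.antidiagonal 3).over (w.1.adicCompletion L)) 0 M ∧
          mapGL ((localNonsplitEquiv (IsCMField.complexConj L) (Matrix.of fun i j : Fin 3 => if i.val + j.val + 1 = 3 then (1 : L) else 0) (IsCMField.complexConj_ne_one L) w hw δ :
            ↥(unitaryGroupOfForm (galAdicCompletionMap (L := L) (IsCMField.complexConj L) hw) (placeForm (Matrix.of fun i j : Fin 3 => if i.val + j.val + 1 = 3 then (1 : L) else 0) w.1))) : GL (Fin 3) (w.1.adicCompletion L)) M = M ∧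
          (LatticeInLevel ϖ a ((((localNonsplitEquiv (IsCMField.complexConj L) (Matrix.of fun i j : Fin 3 => if i.val + j.val + 1 = 3 then (1 : L) else 0) (IsCMField.complexConj_ne_one L) w hw δ :
            ↥(unitaryGroupOfForm (galAdicCompletionMap (L := L) (IsCMField.complexConj L) hw) (placeForm (Matrix.of fun i j : Fin 3 => if i.val + j.val + 1 = 3 then (1 : L) else 0) w.1))) : GL (Fin 3) (w.1.adicCompletion L)) : Matrix (Fin 3) (Fin 3) (w.1.adicCompletion L)) - 1) M ∧
            LatticeInLevel ϖ b (((((localNonsplitEquiv (IsCMField.complexConj L) (Matrix.of fun i j : Fin 3 => if i.val + j.val + 1 = 3 then (1 : L) else 0) (IsCMField.complexConj_ne_one L) w hw δ :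
              ↥(unitaryGroupOfForm (galAdicCompletionMap (L := L) (IsCMField.complexConj L) hw) (placeForm (Matrix.of fun i j : Fin 3 => if i.val + j.val + 1 = 3 then (1 : L) else 0) w.1))) : GL (Fin 3) (w.1.adicCompletion L)) : Matrix (Fin 3) (Fin 3) (w.1.adicCompletion L)) - 1) *
              ((((localNonsplitEquiv (IsCMField.complexConj L) (Matrix.of fun i j : Fin 3 => if i.val + j.val + 1 = 3 then (1 : L) else 0) (IsCMField.complexConj_ne_one L) w hw δ :
              ↥(unitaryGroupOfForm (galAdicCompletionMap (L := L) (IsCMField.complexConj L) hw) (placeForm (Matrix.of fun i j : Fin 3 => if i.val + j.val + 1 = 3 then (1 : L) else 0) w.1))) : GL (Fin 3) (w.1.adicCompletion L)) : Matrix (Fin 3) (Fin 3) (w.1.adicCompletion L)) - 1)) M)}.ncard := by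
  -- `ι_w` as a homomorphism `G_v →* GL₃(L_w)`
  let ι : ((UnitaryGroup.cmDatum L 3 (Matrix.of fun i j : Fin 3 => if i.val + j.val + 1 = 3 then (1 : L) else 0)).Local v) →* GL (Fin 3) (w.1.adicCompletion L) :=
    (Subgroup.subtype _).comp (localNonsplitEquiv (IsCMField.complexConj L) (Matrix.of fun i j : Fin 3 => if i.val + j.val + 1 = 3 then (1 : L) else 0) (IsCMField.complexConj_ne_one L) w hw).toMulEquiv.toMonoidHom
  have hιe : ∀ u, ι u = ((localNonsplitEquiv (IsCMField.complexConj L) (Matrix.of fun i j : Fin 3 => if i.val + j.val + 1 = 3 then (1 : L) else 0) (IsCMField.complexConj_ne_one L) w hw u :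
        ↥(unitaryGroupOfForm (galAdicCompletionMap (L := L) (IsCMField.complexConj L) hw) (placeForm (Matrix.of fun i j : Fin 3 => if i.val + j.val + 1 = 3 then (1 : L) else 0) w.1))) : GL (Fin 3) (w.1.adicCompletion L)) := fun _ => rfl
  obtain ⟨c, hc⟩ := isConj_iff.1 hconj
  have hδ' : ι δ' = ι c * ι δ * (ι c)⁻¹ := by rw [← hc, map_mul, map_mul, map_inv]
  have hcU : ι c ∈ unitaryGroupOfForm (galAdicCompletionMap (L := L) (IsCMField.complexConj L) hw) ((StdForm.antidiagonal 3).over (w.1.adicCompletion L)) := by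
    rw [hιe]; exact coe_mem_unitaryGroupOfForm_over L w hw c
  rw [← hιe δ', ← hιe δ, hδ']
  exact ncard_typeZero_fixed_levels_conj_eq (galAdicCompletionMap (L := L) (IsCMField.complexConj L) hw) ϖ a b (ι c) (ι δ) hcU

end Summit.HodgeConjecture.HodgeConjecture.Cruxes.H413.F0P3cDyRamLevelsCensusClassFunction

end
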